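/-
Copyright: internal research formalization. Source texts: G. Kempf, F. Knudsen, D. Mumford,
B. Saint-Donat, Toroidal Embeddings I (LNM 339, Springer 1973) [KempfEtAl1973], Ch. II §2
(barycentric subdivision of a conical complex: "f.r.p.p. decompositions", proof of Thm. 11*
via Ch. I §2 Lemma 2 at the barycentres); W. Fulton, Introduction to Toric Varieties
[Fulton1993Toric], §1.2 pp. 9–14 (faces, extreme rays, "a strongly convex cone is generated by its
minimal generators / edges"), §2.6 p. 48 ("the first lattice points along the edges");
G. Ewald, Combinatorial Convexity and Algebraic Geometry [Ewald1996], III §2 (stellar and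
barycentric subdivision), V §4.
-/
import Mathlib
import HarnessLib
import Literature.Geometry.PolyhedralFans.LinkTransport

/-!
# Primitive ray generators, barycentres of rational cones, chains and flag cones

Topic: `Literature/Geometry/PolyhedralFans` (block A2 "flag cones" of the LINKED-KKMS programme,
W8.1 / Kato (10.4) atlas form, summit `ResolutionOfSingularities`). The barycentric subdivision of
a fan `Δ₀` — used in [KempfEtAl1973] Ch. II §2 to make the regular projective subdivision of a
conical COMPLEX compatible with all chart changes — is the iterated star subdivision at the
barycentres `b_σ` of the cones, taken by decreasing dimension; its cones are the FLAG CONES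
`hull {b_φ : φ ∈ Φ}` of the chains `Φ` of nonzero cones of `Δ₀`. This file supplies the
canonical (hence chart-compatible) ingredients:

* `ray_isFaceOf_of_not_mem_hull` — **a minimal generator of a salient polyhedral cone spans a
  face ray** ([Fulton1993Toric] §1.2 p. 14: the minimal generators of a strongly convex cone are
  unique up to positive scalars and generate its edges); `exists_minimal_generators`;
* `primRayGens σ` — the PRIMITIVE RAY GENERATORS of a rational polyhedral cone: the primitive
  lattice vectors `p` whose ray `ℚ_{≥0} p` is a face of `σ` ("the first lattice points along the
  edges", [Fulton1993Toric] §2.6 p. 48); finite; **`hull_primRayGens`**: a salient rational cone is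
  the hull of its primitive ray generators; **`primRayGens_map`**: transport along a link
  (`LinkTransport.lean`) — `primRayGens (σ.map E) = (primRayGens σ).image E`;
* `bary σ := Σ_{p ∈ primRayGens σ} p` — the BARYCENTRE: a lattice point of `σ` lying in no proper
  face (`eq_of_isFaceOf_of_bary_mem`), nonzero for `σ ≠ 0`, link-equivariant
  (`bary_map : bary (σ.map E) = E (bary σ)`); in a rational fan, `bary σ ∈ τ ↔ σ ≤ τ`
  (`Fan.bary_mem_iff`) and `bary` is injective on the cones;
* chains and flag cones: for a finite chain `Φ` (pairwise comparable) of nonzero cones of a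
  rational fan, the barycentres are linearly independent
  (`Fan.linearIndepOn_bary_of_isChain`: each apex lies outside the span of the previous cone),
  `flagCone Φ := hull (bary '' Φ)` is a simplicial rational cone contained in the top of the
  chain, its faces are the flag cones of the sub-chains, and flag cones are transported along
  links (`flagCone_map`).

All statements PROVED; no named facts. Definitions: `primRayGens`, `bary`, `flagCone`.

## Not here

The identification "iterated star subdivision at the barycentres by decreasing dimension = flag
fan" (block A3) and the synchronised subdivision loop (A4/A5, `MultiStarSubdivision.lean`).
-/

noncomputable section

namespace Literature.Geometry.PolyhedralFans

open PointedCone Finset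

/-! ## Minimal generators of a salient cone span face rays -/

section RayFaces

variable {𝕜 : Type*} [Field 𝕜] [LinearOrder 𝕜] [IsStrictOrderedRing 𝕜]
variable {V : Type*} [AddCommGroup V] [Module 𝕜 V]

/-- In a salient cone `σ = ℚ_{≥0} t + σ₀` with `t ∉ σ₀`: if `u + v` is a multiple of `t` for
`u, v ∈ σ`, then `u` lies on the ray of `t` (the computation behind "minimal generators are
extreme", [Fulton1993Toric] §1.2 p. 14). [cite: Fulton1993Toric, §1.2 p. 14] -/
theorem mem_ray_of_add_eq_smul {σ σ₀ : PointedCone 𝕜 V} (hsal : IsSalient σ) {t : V}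
    (hσ : σ = σ₀ ⊔ ray 𝕜 t) (ht : t ∉ σ₀) {u v : V} (hu : u ∈ σ) (hv : v ∈ σ) {c : 𝕜}
    (huv : u + v = c • t) : u ∈ ray 𝕜 t := by
  have hσ₀σ : σ₀ ≤ σ := by rw [hσ]; exact le_sup_left
  have htσ : t ∈ σ := by rw [hσ]; exact self_mem_sup_ray σ₀ t
  rw [hσ] at hu hv
  obtain ⟨u₀, hu₀, α, hα, rfl⟩ := mem_sup_ray_iff.mp hu
  obtain ⟨v₀, hv₀, β, hβ, rfl⟩ := mem_sup_ray_iff.mp hv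
  have hkey : (c - α - β) • t = u₀ + v₀ := by
    have : u₀ + v₀ = (u₀ + α • t + (v₀ + β • t)) - (α + β) • t := by rw [add_smul]; abel
    rw [this, huv, ← sub_smul]; ring_nf
  have hsum : u₀ + v₀ ∈ σ₀ := σ₀.add_mem hu₀ hv₀
  rcases lt_trichotomy 0 (c - α - β) with hpos | hzero | hneg
  · -- `t ∈ σ₀`: contradiction
    exact absurd ((PointedCone.smul_mem_iff σ₀ hpos).mp (hkey ▸ hsum)) ht
  · -- `u₀ = -v₀ ∈ σ ∩ (−σ)`, so `u₀ = 0`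
    have h0 : u₀ + v₀ = 0 := by rw [← hkey, ← hzero, zero_smul]
    have hu₀0 : u₀ = 0 := by
      have hneg : -u₀ = v₀ := (neg_eq_of_add_eq_zero_right h0)
      exact hsal (hσ₀σ hu₀) (hneg ▸ hσ₀σ hv₀)
    rw [hu₀0, zero_add]
    exact mem_ray_iff.mpr ⟨α, hα, rfl⟩
  · -- `-t ∈ σ`: contradiction with salience (`t ≠ 0` as `t ∉ σ₀`)
    have hnegt : -t ∈ σ := by
      have h1 : (α + β - c) • (-t) = u₀ + v₀ := by rw [smul_neg, ← neg_smul, ← hkey]; ring_nf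
      have hpos' : 0 < α + β - c := by linarith
      exact (PointedCone.smul_mem_iff σ hpos').mp (h1 ▸ hσ₀σ hsum)
    have ht0 : t = 0 := hsal htσ hnegt
    exact absurd (ht0 ▸ σ₀.zero_mem) ht

/-- **A minimal generator of a salient polyhedral cone spans a face ray**: if `σ` is the hull of a
finite set `T` and `t ∈ T` does not lie in the hull of the other generators, then `ℚ_{≥0} t` is a
face of `σ` ([Fulton1993Toric] §1.2 p. 14: a strongly convex cone is generated by its edges, which
are spanned by the minimal generators). [cite: Fulton1993Toric, §1.2 p. 14] -/
theorem ray_isFaceOf_of_not_mem_hull [DecidableEq V] {σ : PointedCone 𝕜 V} (hsal : IsSalient σ)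
    {T : Finset V} (hσ : σ = PointedCone.hull 𝕜 (T : Set V)) {t : V} (ht : t ∈ T)
    (hmin : t ∉ PointedCone.hull 𝕜 ((T.erase t : Finset V) : Set V)) : (ray 𝕜 t).IsFaceOf σ := by
  have hσ' : σ = PointedCone.hull 𝕜 ((T.erase t : Finset V) : Set V) ⊔ ray 𝕜 t := by
    rw [hσ, ← hull_insert, Finset.coe_erase, Set.insert_sdiff_singleton,
      Set.insert_eq_of_mem (Finset.mem_coe.mpr ht)]
  have htσ : t ∈ σ := by rw [hσ]; exact PointedCone.subset_hull (Finset.mem_coe.mpr ht)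
  refine ⟨?_, fun {x} {y} {a} hx hy ha hxy => ?_⟩
  · rw [ray, PointedCone.hull, Submodule.span_le, Set.singleton_subset_iff]; exact htσ
  · obtain ⟨c, -, hc⟩ := mem_ray_iff.mp hxy
    have hax : a • x ∈ ray 𝕜 t :=
      mem_ray_of_add_eq_smul hsal hσ' hmin (σ.smul_mem ha.le hx) hy hc
    have : x = a⁻¹ • (a • x) := by rw [smul_smul, inv_mul_cancel₀ ha.ne', one_smul]
    rw [this]
    exact (ray 𝕜 t).smul_mem (inv_pos.mpr ha).le hax

/-- **Minimal generating subsets exist**: every finite generating set contains a generating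
subset none of whose members lies in the hull of the others. [cite: Fulton1993Toric, §1.2 p. 14] -/
theorem exists_minimal_generators [DecidableEq V] (T : Finset V) :
    ∃ T' ⊆ T, PointedCone.hull 𝕜 (T' : Set V) = PointedCone.hull 𝕜 (T : Set V) ∧
      ∀ t ∈ T', t ∉ PointedCone.hull 𝕜 ((T'.erase t : Finset V) : Set V) := by
  classical
  set P : Finset (Finset V) := T.powerset.filter fun T' : Finset V =>
    PointedCone.hull 𝕜 (↑T' : Set V) = PointedCone.hull 𝕜 (T : Set V) with hP
  have hPne : P.Nonempty := ⟨T, by rw [hP, Finset.mem_filter]; exact ⟨Finset.mem_powerset_self T, rfl⟩⟩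
  obtain ⟨T', hT'P, hmin⟩ := Finset.exists_min_image P Finset.card hPne
  obtain ⟨hT'T, hT'eq⟩ := Finset.mem_filter.mp hT'P
  refine ⟨T', Finset.mem_powerset.mp hT'T, hT'eq, fun t ht htmem => ?_⟩
  -- `T'.erase t` also generates: contradiction with minimality of the cardinality
  have hgen : PointedCone.hull 𝕜 ((T'.erase t : Finset V) : Set V) =
      PointedCone.hull 𝕜 (T : Set V) := by
    rw [← hT'eq]
    apply le_antisymm (Submodule.span_mono (by rw [Finset.coe_erase]; exact fun x hx => hx.1))
    refine Submodule.span_le.mpr ?_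
    intro s hs
    by_cases hst : s = t
    · rw [hst]; exact htmem
    · exact PointedCone.subset_hull (Finset.mem_coe.mpr (Finset.mem_erase.mpr ⟨hst, hs⟩))
  have hmemP : T'.erase t ∈ P := by
    rw [hP, Finset.mem_filter, Finset.mem_powerset]
    exact ⟨(Finset.erase_subset t T').trans (Finset.mem_powerset.mp hT'T), hgen⟩
  have := hmin _ hmemP
  rw [Finset.card_erase_of_mem ht] at this
  have hpos : 0 < T'.card := Finset.card_pos.mpr ⟨t, ht⟩
  omega

/-- The ray through a nonzero element `x` of a face ray `ℚ_{≥0} t` is that face ray.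
[cite: Fulton1993Toric, §1.2 p. 14] -/
theorem ray_eq_ray_of_mem_ray {t x : V} (hx : x ∈ ray 𝕜 t) (hx0 : x ≠ 0) :
    ray 𝕜 x = ray 𝕜 t := by
  obtain ⟨c, hc, rfl⟩ := mem_ray_iff.mp hx
  rcases hc.lt_or_eq with hc | rfl
  · exact ray_smul_eq hc
  · exact absurd (zero_smul 𝕜 t) hx0

/-- A proper face has strictly smaller span: if a face `F` of `σ` spans the span of `σ` then
`F = σ` (`σ ∩ span F = F`). [cite: Fulton1993Toric, §1.2 p. 10] -/
theorem eq_of_isFaceOf_of_span_le {F σ : PointedCone 𝕜 V} (hF : F.IsFaceOf σ)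
    (h : (σ : Set V) ⊆ Submodule.span 𝕜 (F : Set V)) : F = σ :=
  le_antisymm hF.le fun _ hx => mem_of_isFaceOf_of_mem_span hF hx (h hx)

/-- **A proper face has strictly smaller dimension** (finite-dimensional ambient space): for a
face `F ≠ σ`, `dim span F < dim span σ`. [cite: Fulton1993Toric, §1.2 p. 10] -/
theorem finrank_span_lt_of_isFaceOf_ne [FiniteDimensional 𝕜 V] {F σ : PointedCone 𝕜 V}
    (hF : F.IsFaceOf σ) (hne : F ≠ σ) :
    Module.finrank 𝕜 (Submodule.span 𝕜 (F : Set V)) <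
      Module.finrank 𝕜 (Submodule.span 𝕜 (σ : Set V)) := by
  have hle : Submodule.span 𝕜 (F : Set V) ≤ Submodule.span 𝕜 (σ : Set V) :=
    Submodule.span_mono hF.le
  refine lt_of_le_of_ne (Submodule.finrank_mono hle) fun heq => hne ?_
  have hspan := Submodule.eq_of_le_of_finrank_eq hle heq
  exact eq_of_isFaceOf_of_span_le hF (hspan ▸ Submodule.subset_span)

end RayFaces

/-! ## Primitive ray generators and the barycentre of a rational cone -/

section Rational

variable {κ : Type*}

/-- A cone in `ℚ^κ` is **rational polyhedral** if it is the hull of finitely many lattice vectors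
([Fulton1993Toric] §1.2 p. 9 / §1.4 p. 20). [cite: Fulton1993Toric, §1.4 p. 20] -/
def IsRationalCone (σ : PointedCone ℚ (κ → ℚ)) : Prop :=
  ∃ T : Finset (κ → ℚ), (↑T ⊆ (latticeN κ : Set (κ → ℚ))) ∧ σ = PointedCone.hull ℚ ↑T

/-- A rational polyhedral cone is finitely generated. [cite: Fulton1993Toric, §1.2 p. 9] -/
theorem IsRationalCone.fg {σ : PointedCone ℚ (κ → ℚ)} (h : IsRationalCone σ) : σ.FG := by
  obtain ⟨T, -, rfl⟩ := h
  exact ⟨T, rfl⟩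

/-- The cones of a rational fan are rational polyhedral cones. [cite: Fulton1993Toric, §1.4 p. 20] -/
theorem Fan.IsRational.isRationalCone {Δ : Fan ℚ (κ → ℚ)} (h : Δ.IsRational)
    {σ : PointedCone ℚ (κ → ℚ)} (hσ : σ ∈ Δ.cones) : IsRationalCone σ :=
  h hσ

/-- The set of primitive lattice vectors spanning face rays of a finitely generated cone is
finite (each determines its ray, a face, and the faces are finite).
[cite: Fulton1993Toric, §1.2 (7) p. 11] -/
theorem finite_setOf_isPrimitive_ray_isFaceOf {σ : PointedCone ℚ (κ → ℚ)} (hfg : σ.FG) :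
    {p : κ → ℚ | IsPrimitive p ∧ (ray ℚ p).IsFaceOf σ}.Finite := by
  refine Set.Finite.of_finite_image (f := fun p => ray ℚ p) ?_ ?_
  · exact (finite_setOf_isFaceOf hfg).subset (by rintro _ ⟨p, hp, rfl⟩; exact hp.2)
  · intro p hp q hq h
    exact hp.1.eq_of_ray_eq hq.1 h

open Classical in
/-- The **primitive ray generators** of a cone in `ℚ^κ`: the primitive lattice vectors `p` whose
ray `ℚ_{≥0} p` is a face of `σ` ("the first lattice points along the edges", [Fulton1993Toric]
§2.6 p. 48; the edges = one-dimensional faces of [Fulton1993Toric] §1.2 p. 14), as a finite set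
(junk value `∅` if there are infinitely many, which does not happen for polyhedral cones,
`mem_primRayGens_iff`). A canonical datum of the cone, hence compatible with chart changes
(`primRayGens_map`). [cite: Fulton1993Toric, §2.6 p. 48] -/
def primRayGens (σ : PointedCone ℚ (κ → ℚ)) : Finset (κ → ℚ) :=
  if h : {p : κ → ℚ | IsPrimitive p ∧ (ray ℚ p).IsFaceOf σ}.Finite then h.toFinset else ∅

/-- Membership in `primRayGens` for a finitely generated cone. [cite: Fulton1993Toric, §2.6 p. 48] -/
theorem mem_primRayGens_iff {σ : PointedCone ℚ (κ → ℚ)} (hfg : σ.FG) {p : κ → ℚ} :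
    p ∈ primRayGens σ ↔ IsPrimitive p ∧ (ray ℚ p).IsFaceOf σ := by
  rw [primRayGens, dif_pos (finite_setOf_isPrimitive_ray_isFaceOf hfg), Set.Finite.mem_toFinset]
  rfl

/-- Primitive ray generators are elements of the cone. [cite: Fulton1993Toric, §2.6 p. 48] -/
theorem mem_of_mem_primRayGens {σ : PointedCone ℚ (κ → ℚ)} (hfg : σ.FG) {p : κ → ℚ}
    (hp : p ∈ primRayGens σ) : p ∈ σ :=
  ((mem_primRayGens_iff hfg).mp hp).2.le (self_mem_ray p)

/-- Primitive ray generators are lattice vectors. [cite: Fulton1993Toric, §2.6 p. 48] -/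
theorem mem_latticeN_of_mem_primRayGens {σ : PointedCone ℚ (κ → ℚ)} (hfg : σ.FG) {p : κ → ℚ}
    (hp : p ∈ primRayGens σ) : p ∈ latticeN κ :=
  ((mem_primRayGens_iff hfg).mp hp).1.1

/-- The hull of the primitive ray generators lies in the cone. [cite: Fulton1993Toric, §2.6 p. 48] -/
theorem hull_primRayGens_le {σ : PointedCone ℚ (κ → ℚ)} (hfg : σ.FG) :
    PointedCone.hull ℚ ((primRayGens σ : Finset (κ → ℚ)) : Set (κ → ℚ)) ≤ σ :=
  Submodule.span_le.mpr fun _ hp => mem_of_mem_primRayGens hfg (Finset.mem_coe.mp hp)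

/-- **A salient rational polyhedral cone is the hull of its primitive ray generators**
([Fulton1993Toric] §1.2 p. 14 with §2.6 p. 48: generated by the first lattice points along its
edges). Proof: a minimal lattice generating set consists of nonzero vectors spanning face rays
(`ray_isFaceOf_of_not_mem_hull`), and the primitive vector on each such ray is a primitive ray
generator. [cite: Fulton1993Toric, §1.2 p. 14] -/
theorem hull_primRayGens {σ : PointedCone ℚ (κ → ℚ)} (hrat : IsRationalCone σ)
    (hsal : IsSalient σ) :
    PointedCone.hull ℚ ((primRayGens σ : Finset (κ → ℚ)) : Set (κ → ℚ)) = σ := by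
  classical
  have hfg := hrat.fg
  refine le_antisymm (hull_primRayGens_le hfg) ?_
  obtain ⟨T, hTN, hσT⟩ := hrat
  obtain ⟨T', hT'T, hT'eq, hmin⟩ := exists_minimal_generators (𝕜 := ℚ) T
  have hσT' : σ = PointedCone.hull ℚ (T' : Set (κ → ℚ)) := by rw [hT'eq]; exact hσT
  -- every minimal generator lies in the hull of the primitive ray generators
  have hgen : ∀ t ∈ T',
      t ∈ PointedCone.hull ℚ ((primRayGens σ : Finset (κ → ℚ)) : Set (κ → ℚ)) := by
    intro t ht'
    have ht0 : t ≠ 0 := by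
      rintro rfl
      exact hmin 0 ht' (Submodule.zero_mem _)
    have hray : (ray ℚ t).IsFaceOf σ := ray_isFaceOf_of_not_mem_hull hsal hσT' ht' (hmin t ht')
    obtain ⟨c, hc, -, hprim⟩ := exists_isPrimitive_smul (hTN (Finset.mem_coe.mpr (hT'T ht'))) ht0
    have hp : c • t ∈ primRayGens σ :=
      (mem_primRayGens_iff hfg).mpr ⟨hprim, by rwa [ray_smul_eq hc]⟩
    have htc : t = c⁻¹ • (c • t) := by rw [smul_smul, inv_mul_cancel₀ hc.ne', one_smul]
    rw [htc]
    exact smul_mem_of_nonneg (PointedCone.subset_hull (Finset.mem_coe.mpr hp)) (inv_pos.mpr hc).le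
  have hle : PointedCone.hull ℚ (T' : Set (κ → ℚ)) ≤
      PointedCone.hull ℚ ((primRayGens σ : Finset (κ → ℚ)) : Set (κ → ℚ)) :=
    Submodule.span_le.mpr fun t ht => hgen t (Finset.mem_coe.mp ht)
  exact hσT'.le.trans hle

/-- The hull of the primitive ray generators is a rational cone description of `σ`: a salient
rational cone is `IsRationalCone` with generating set `primRayGens σ`.
[cite: Fulton1993Toric, §2.6 p. 48] -/
theorem isRationalCone_primRayGens {σ : PointedCone ℚ (κ → ℚ)} (hrat : IsRationalCone σ)
    (hsal : IsSalient σ) :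
    ↑(primRayGens σ) ⊆ (latticeN κ : Set (κ → ℚ)) ∧
      σ = PointedCone.hull ℚ ((primRayGens σ : Finset (κ → ℚ)) : Set (κ → ℚ)) :=
  ⟨fun _ hp => mem_latticeN_of_mem_primRayGens hrat.fg (Finset.mem_coe.mp hp),
    (hull_primRayGens hrat hsal).symm⟩

/-- The zero cone has no primitive ray generators. [cite: Fulton1993Toric, §1.2 p. 14] -/
theorem primRayGens_bot : primRayGens (⊥ : PointedCone ℚ (κ → ℚ)) = ∅ := by
  ext p
  simp only [Finset.notMem_empty, iff_false]
  intro hp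
  have hfg : (⊥ : PointedCone ℚ (κ → ℚ)).FG := ⟨∅, by simp⟩
  obtain ⟨hprim, hface⟩ := (mem_primRayGens_iff hfg).mp hp
  have : p ∈ (⊥ : PointedCone ℚ (κ → ℚ)) := hface.le (self_mem_ray p)
  exact hprim.2.1 ((Submodule.mem_bot _).mp this)

/-- The **barycentre** of a cone in `ℚ^κ`: the sum of its primitive ray generators — a canonical
lattice point of the relative interior ([KempfEtAl1973] II §2 / [Ewald1996] III §2: the point at
which the barycentric subdivision stars the cone). [cite: KempfEtAl1973, II §2] -/
def bary (σ : PointedCone ℚ (κ → ℚ)) : κ → ℚ := ∑ p ∈ primRayGens σ, p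

/-- The barycentre lies in the cone. [cite: KempfEtAl1973, II §2] -/
theorem bary_mem {σ : PointedCone ℚ (κ → ℚ)} (hfg : σ.FG) : bary σ ∈ σ :=
  σ.sum_mem fun _ hp => mem_of_mem_primRayGens hfg hp

/-- The barycentre is a lattice point. [cite: KempfEtAl1973, II §2] -/
theorem bary_mem_latticeN {σ : PointedCone ℚ (κ → ℚ)} (hfg : σ.FG) : bary σ ∈ latticeN κ :=
  (latticeN κ).sum_mem fun _ hp => mem_latticeN_of_mem_primRayGens hfg hp

/-- **The barycentre lies in no proper face**: a face of a salient rational cone containing its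
barycentre is the whole cone (every primitive ray generator is forced into the face, and they
generate). [cite: KempfEtAl1973, II §2] -/
theorem eq_of_isFaceOf_of_bary_mem {σ F : PointedCone ℚ (κ → ℚ)} (hrat : IsRationalCone σ)
    (hsal : IsSalient σ) (hF : F.IsFaceOf σ) (hb : bary σ ∈ F) : F = σ := by
  have hfg := hrat.fg
  refine le_antisymm hF.le ?_
  rw [← hull_primRayGens hrat hsal]
  refine Submodule.span_le.mpr ?_
  intro p hp
  have hp' : p ∈ primRayGens σ := Finset.mem_coe.mp hp
  have hsum : ∑ i : (primRayGens σ), (i : κ → ℚ) ∈ F := by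
    rw [Finset.sum_coe_sort (primRayGens σ) (fun q => q)]; exact hb
  exact hF.mem_of_sum_mem (f := fun i : (primRayGens σ) => (i : κ → ℚ))
    (fun i => mem_of_mem_primRayGens hfg i.2) hsum ⟨p, hp'⟩

/-- **The barycentre of a nonzero salient rational cone is nonzero** (`0` lies in the proper face
`{0}`). [cite: KempfEtAl1973, II §2] -/
theorem bary_ne_zero {σ : PointedCone ℚ (κ → ℚ)} (hrat : IsRationalCone σ) (hsal : IsSalient σ)
    (hσ : σ ≠ ⊥) : bary σ ≠ 0 := fun h =>
  hσ (eq_of_isFaceOf_of_bary_mem hrat hsal hsal.bot_isFaceOf (by rw [h]; exact Submodule.zero_mem _)).symm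

/-- The barycentre does not lie in the span of a proper face. [cite: KempfEtAl1973, II §2] -/
theorem bary_not_mem_span_of_isFaceOf_ne {σ F : PointedCone ℚ (κ → ℚ)} (hrat : IsRationalCone σ)
    (hsal : IsSalient σ) (hF : F.IsFaceOf σ) (hne : F ≠ σ) :
    bary σ ∉ Submodule.span ℚ (F : Set (κ → ℚ)) := fun h =>
  hne (eq_of_isFaceOf_of_bary_mem hrat hsal hF (mem_of_isFaceOf_of_mem_span hF (bary_mem hrat.fg) h))

namespace Fan

variable {Δ : Fan ℚ (κ → ℚ)}

/-- **In a rational fan, the barycentre of `σ` lies in the cone `τ` iff `σ ≤ τ`** (`σ ∩ τ` is a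
face of `σ` containing `bary σ`). [cite: KempfEtAl1973, II §2] -/
theorem bary_mem_iff (hΔ : Δ.IsRational) {σ τ : PointedCone ℚ (κ → ℚ)} (hσ : σ ∈ Δ.cones)
    (hτ : τ ∈ Δ.cones) : bary σ ∈ τ ↔ σ ≤ τ := by
  refine ⟨fun h => ?_, fun h => h (bary_mem (Δ.fg hσ))⟩
  have hface : (σ ⊓ τ).IsFaceOf σ := Δ.inf_isFaceOf hσ hτ
  have heq := eq_of_isFaceOf_of_bary_mem (hΔ hσ) (Δ.salient hσ) hface
    (Submodule.mem_inf.mpr ⟨bary_mem (Δ.fg hσ), h⟩)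
  exact (inf_eq_left.mp heq)

/-- **The barycentre determines the cone**: `bary` is injective on the cones of a rational fan.
[cite: KempfEtAl1973, II §2] -/
theorem bary_injOn (hΔ : Δ.IsRational) : Set.InjOn bary Δ.cones := fun _ hσ _ hτ h =>
  le_antisymm ((bary_mem_iff hΔ hσ hτ).mp (h ▸ bary_mem (Δ.fg hτ)))
    ((bary_mem_iff hΔ hτ hσ).mp (h ▸ bary_mem (Δ.fg hσ)))

/-- The barycentre of a cone of a rational fan lies in the support. [cite: KempfEtAl1973, II §2] -/
theorem bary_mem_support {σ : PointedCone ℚ (κ → ℚ)} (hσ : σ ∈ Δ.cones) : bary σ ∈ Δ.support :=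
  mem_support.mpr ⟨σ, hσ, bary_mem (Δ.fg hσ)⟩

end Fan

end Rational

/-! ## Transport of primitive ray generators and barycentres along a link -/

section Link

variable {κ κ' : Type*}
variable {E : (κ → ℚ) →ₗ[ℚ] (κ' → ℚ)} {U : Submodule ℚ (κ → ℚ)}

/-- Primitivity is reflected along a link: if `x ∈ U` and `E x` is primitive then so is `x`.
[cite: KempfEtAl1973, II §1 Def. 5] -/
theorem isPrimitive_of_map (hinj : ∀ x ∈ U, E x = 0 → x = 0)
    (hlat : ∀ x ∈ U, x ∈ latticeN κ → E x ∈ latticeN κ')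
    (hlat' : ∀ y ∈ latticeN κ', y ∈ U.map E → ∃ x ∈ U, x ∈ latticeN κ ∧ E x = y)
    {x : κ → ℚ} (hx : x ∈ U) (hp : IsPrimitive (E x)) : IsPrimitive x := by
  refine ⟨(map_mem_latticeN_iff hinj hlat hlat' hx).mp hp.1, fun h0 => hp.2.1 (by rw [h0, map_zero]),
    fun c hc hcx => hp.2.2 c hc ?_⟩
  have := hlat _ (U.smul_mem c hx) hcx
  rwa [map_smul] at this

/-- A rational polyhedral cone inside `U` has rational polyhedral image.
[cite: KempfEtAl1973, II §2 Thm. 4*] -/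
theorem IsRationalCone.map [DecidableEq (κ' → ℚ)]
    (hlat : ∀ x ∈ U, x ∈ latticeN κ → E x ∈ latticeN κ') {σ : PointedCone ℚ (κ → ℚ)}
    (hσ : (σ : Set (κ → ℚ)) ⊆ U) (h : IsRationalCone σ) : IsRationalCone (σ.map E) := by
  obtain ⟨T, hTN, hσT⟩ := h
  refine ⟨T.image E, fun y hy => ?_, by rw [hσT, map_hull_finset]⟩
  obtain ⟨x, hx, rfl⟩ := Finset.mem_image.mp (Finset.mem_coe.mp hy)
  exact hlat x (hσ (hσT ▸ PointedCone.subset_hull (Finset.mem_coe.mpr hx))) (hTN (Finset.mem_coe.mpr hx))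

/-- **Primitive ray generators are transported**: for a polyhedral cone `σ ⊆ U`,
`primRayGens (σ.map E) = E '' primRayGens σ` (face rays and primitive vectors correspond under the
link). [cite: KempfEtAl1973, II §2 Thm. 4*] -/
theorem primRayGens_map [DecidableEq (κ' → ℚ)] (hinj : ∀ x ∈ U, E x = 0 → x = 0)
    (hlat : ∀ x ∈ U, x ∈ latticeN κ → E x ∈ latticeN κ')
    (hlat' : ∀ y ∈ latticeN κ', y ∈ U.map E → ∃ x ∈ U, x ∈ latticeN κ ∧ E x = y)
    {σ : PointedCone ℚ (κ → ℚ)} (hσ : (σ : Set (κ → ℚ)) ⊆ U) (hfg : σ.FG) :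
    primRayGens (σ.map E) = (primRayGens σ).image E := by
  have hfg' : (σ.map E).FG := fg_map E hfg
  have hrayU : ∀ {q : κ → ℚ}, q ∈ U → ((ray ℚ q : PointedCone ℚ (κ → ℚ)) : Set (κ → ℚ)) ⊆ U := by
    intro q hq y hy
    obtain ⟨c, -, rfl⟩ := mem_ray_iff.mp hy
    exact U.smul_mem c hq
  ext p'
  rw [mem_primRayGens_iff hfg', Finset.mem_image]
  constructor
  · rintro ⟨hprim, hface⟩
    obtain ⟨F, hF, hFE⟩ := exists_isFaceOf_map_eq_of_isFaceOf_map E hface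
    have hp'F : p' ∈ F.map E := by rw [hFE]; exact self_mem_ray p'
    obtain ⟨q, hqF, rfl⟩ := PointedCone.mem_map.mp hp'F
    have hqU : q ∈ U := hσ (hF.le hqF)
    have hFU : (F : Set (κ → ℚ)) ⊆ U := fun x hx => hσ (hF.le hx)
    have hFeq : ray ℚ q = F := by
      rw [← map_eq_map_iff_of_subset hinj (hrayU hqU) hFU, map_ray, hFE]
    refine ⟨q, (mem_primRayGens_iff hfg).mpr ⟨isPrimitive_of_map hinj hlat hlat' hqU hprim, ?_⟩, rfl⟩
    rw [hFeq]; exact hF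
  · rintro ⟨q, hq, rfl⟩
    obtain ⟨hprim, hface⟩ := (mem_primRayGens_iff hfg).mp hq
    have hqU : q ∈ U := hσ (hface.le (self_mem_ray q))
    refine ⟨isPrimitive_map hinj hlat hlat' hqU hprim, ?_⟩
    rw [← map_ray]
    exact isFaceOf_map_of_isFaceOf hinj hface hσ

/-- **The barycentre is link-equivariant**: `bary (σ.map E) = E (bary σ)` for a polyhedral cone
`σ ⊆ U` ([KempfEtAl1973] II §2: the barycentric subdivision of a complex is well defined because
the barycentres agree on overlaps). [cite: KempfEtAl1973, II §2 Thm. 4*] -/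
theorem bary_map [DecidableEq (κ' → ℚ)] (hinj : ∀ x ∈ U, E x = 0 → x = 0)
    (hlat : ∀ x ∈ U, x ∈ latticeN κ → E x ∈ latticeN κ')
    (hlat' : ∀ y ∈ latticeN κ', y ∈ U.map E → ∃ x ∈ U, x ∈ latticeN κ ∧ E x = y)
    {σ : PointedCone ℚ (κ → ℚ)} (hσ : (σ : Set (κ → ℚ)) ⊆ U) (hfg : σ.FG) :
    bary (σ.map E) = E (bary σ) := by
  rw [bary, bary, primRayGens_map hinj hlat hlat' hσ hfg,
    map_sum_eq_sum_image hinj fun p hp => hσ (mem_of_mem_primRayGens hfg (Finset.mem_coe.mp hp))]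

end Link

/-! ## Chains of cones and flag cones -/

section Flag

variable {κ : Type*}

/-- The **flag cone** of a set `Φ` of cones: the hull of their barycentres. For a chain
`φ₁ < φ₂ < ⋯ < φ_r` of nonzero cones of a rational fan this is the simplicial cone
`ℚ_{≥0} b_{φ₁} + ⋯ + ℚ_{≥0} b_{φ_r}` of the barycentric subdivision ([KempfEtAl1973] II §2;
[Ewald1996] III §2). [cite: KempfEtAl1973, II §2] -/
def flagCone (Φ : Set (PointedCone ℚ (κ → ℚ))) : PointedCone ℚ (κ → ℚ) :=
  PointedCone.hull ℚ (bary '' Φ)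

/-- Flag cones are monotone in the chain. [cite: KempfEtAl1973, II §2] -/
theorem flagCone_mono {Φ Ψ : Set (PointedCone ℚ (κ → ℚ))} (h : Φ ⊆ Ψ) : flagCone Φ ≤ flagCone Ψ :=
  Submodule.span_mono (Set.image_mono h)

/-- The flag cone of the empty chain is the zero cone. [cite: KempfEtAl1973, II §2] -/
theorem flagCone_empty : flagCone (∅ : Set (PointedCone ℚ (κ → ℚ))) = ⊥ := by
  rw [flagCone, Set.image_empty]
  exact Submodule.span_empty

/-- The barycentre of a member of `Φ` lies in the flag cone. [cite: KempfEtAl1973, II §2] -/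
theorem bary_mem_flagCone {Φ : Set (PointedCone ℚ (κ → ℚ))} {φ : PointedCone ℚ (κ → ℚ)}
    (hφ : φ ∈ Φ) : bary φ ∈ flagCone Φ :=
  PointedCone.subset_hull ⟨φ, hφ, rfl⟩

/-- A flag cone lies in any cone containing all members of `Φ` (in particular in the top of a
chain). [cite: KempfEtAl1973, II §2] -/
theorem flagCone_le {Φ : Set (PointedCone ℚ (κ → ℚ))} {μ : PointedCone ℚ (κ → ℚ)}
    (hfg : ∀ φ ∈ Φ, φ.FG) (hΦ : ∀ φ ∈ Φ, φ ≤ μ) : flagCone Φ ≤ μ := by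
  refine Submodule.span_le.mpr ?_
  rintro _ ⟨φ, hφ, rfl⟩
  exact hΦ φ hφ (bary_mem (hfg φ hφ))

/-- The flag cone of a finite set of cones, as the hull of a finite set of vectors.
[cite: KempfEtAl1973, II §2] -/
theorem flagCone_coe [DecidableEq (κ → ℚ)] (Φ : Finset (PointedCone ℚ (κ → ℚ))) :
    flagCone (Φ : Set (PointedCone ℚ (κ → ℚ))) =
      PointedCone.hull ℚ ((Φ.image bary : Finset (κ → ℚ)) : Set (κ → ℚ)) := by
  rw [flagCone, Finset.coe_image]

/-- Flag cones of cones with lattice barycentres (e.g. polyhedral cones) are rational polyhedral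
cones. [cite: KempfEtAl1973, II §2] -/
theorem isRationalCone_flagCone (Φ : Finset (PointedCone ℚ (κ → ℚ))) (hfg : ∀ φ ∈ Φ, φ.FG) :
    IsRationalCone (flagCone (Φ : Set (PointedCone ℚ (κ → ℚ)))) := by
  classical
  refine ⟨Φ.image bary, fun x hx => ?_, flagCone_coe Φ⟩
  obtain ⟨φ, hφ, rfl⟩ := Finset.mem_image.mp (Finset.mem_coe.mp hx)
  exact bary_mem_latticeN (hfg φ hφ)

/-- **Faces of a flag cone are flag cones of sub-chains** (a face of the hull of a finite set is
the hull of the generators it contains). [cite: KempfEtAl1973, II §2] -/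
theorem exists_eq_flagCone_of_isFaceOf (Φ : Finset (PointedCone ℚ (κ → ℚ)))
    {F : PointedCone ℚ (κ → ℚ)} (hF : F.IsFaceOf (flagCone (Φ : Set (PointedCone ℚ (κ → ℚ))))) :
    ∃ Ψ : Finset (PointedCone ℚ (κ → ℚ)), Ψ ⊆ Φ ∧ F = flagCone (Ψ : Set (PointedCone ℚ (κ → ℚ))) := by
  classical
  rw [flagCone_coe] at hF
  refine ⟨Φ.filter fun φ => bary φ ∈ F, Finset.filter_subset _ _, ?_⟩
  have hFeq := eq_hull_filter_of_isFaceOf_hull hF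
  have hset : ((Φ.filter fun φ => bary φ ∈ F).image bary) = (Φ.image bary).filter (· ∈ F) := by
    ext x
    simp only [Finset.mem_filter, Finset.mem_image]
    constructor
    · rintro ⟨φ, ⟨hφ, hx⟩, rfl⟩
      exact ⟨⟨φ, hφ, rfl⟩, hx⟩
    · rintro ⟨⟨φ, hφ, rfl⟩, hx⟩
      exact ⟨φ, ⟨hφ, hx⟩, rfl⟩
  rw [flagCone_coe, hset]
  exact hFeq

/-- **Flag cones are transported along links**: `(flagCone Φ).map E = flagCone (E Φ)` for
polyhedral cones inside `U`. [cite: KempfEtAl1973, II §2 Thm. 4*] -/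
theorem flagCone_map {κ' : Type*} [DecidableEq (κ' → ℚ)] {E : (κ → ℚ) →ₗ[ℚ] (κ' → ℚ)}
    {U : Submodule ℚ (κ → ℚ)} (hinj : ∀ x ∈ U, E x = 0 → x = 0)
    (hlat : ∀ x ∈ U, x ∈ latticeN κ → E x ∈ latticeN κ')
    (hlat' : ∀ y ∈ latticeN κ', y ∈ U.map E → ∃ x ∈ U, x ∈ latticeN κ ∧ E x = y)
    {Φ : Set (PointedCone ℚ (κ → ℚ))} (hΦU : ∀ φ ∈ Φ, (φ : Set (κ → ℚ)) ⊆ U)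
    (hfg : ∀ φ ∈ Φ, φ.FG) :
    (flagCone Φ).map E = flagCone ((fun φ => φ.map E) '' Φ) := by
  rw [flagCone, flagCone, map_hull, Set.image_image, Set.image_image]
  congr 1
  refine Set.image_congr fun φ hφ => ?_
  exact (bary_map hinj hlat hlat' (hΦU φ hφ) (hfg φ hφ)).symm

/-- Chains of cones are transported along links (images of comparable cones are comparable).
[cite: KempfEtAl1973, II §2 Thm. 4*] -/
theorem isChain_image_map {κ' : Type*} (E : (κ → ℚ) →ₗ[ℚ] (κ' → ℚ))
    {Φ : Set (PointedCone ℚ (κ → ℚ))} (hch : IsChain (· ≤ ·) Φ) :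
    IsChain (· ≤ ·) ((fun φ => φ.map E) '' Φ) :=
  IsChain.image_of_map_rel _ _ _ (fun _ _ h => map_mono' E h) hch

namespace Fan

variable {Δ : Fan ℚ (κ → ℚ)}

/-- In a chain of cones of a fan with a maximal member `μ`, every member is `≤ μ`.
[cite: KempfEtAl1973, II §2] -/
theorem le_of_maximal_of_isChain {Φ : Finset (PointedCone ℚ (κ → ℚ))}
    (hch : IsChain (· ≤ ·) (Φ : Set (PointedCone ℚ (κ → ℚ)))) {μ : PointedCone ℚ (κ → ℚ)}
    (hμ : Maximal (· ∈ Φ) μ) {φ : PointedCone ℚ (κ → ℚ)} (hφ : φ ∈ Φ) : φ ≤ μ := by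
  by_cases h : φ = μ
  · exact h.le
  · rcases hch (Finset.mem_coe.mpr hφ) (Finset.mem_coe.mpr hμ.1) h with hle | hle
    · exact hle
    · exact hμ.2 hφ hle

/-- **The barycentres of a chain of nonzero cones of a rational fan are linearly independent**
([KempfEtAl1973] II §2 / [Ewald1996] III §2: the barycentric subdivision is simplicial). Proof:
the barycentre of the top cone lies outside the span of the next one (`bary_not_mem_span_of_isFaceOf_ne`),
which contains the barycentres of all smaller members; induction on the chain.
[cite: KempfEtAl1973, II §2] -/
theorem linearIndepOn_bary_of_isChain (hΔ : Δ.IsRational) :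
    ∀ (Φ : Finset (PointedCone ℚ (κ → ℚ))), ↑Φ ⊆ Δ.cones → ⊥ ∉ Φ →
      IsChain (· ≤ ·) (Φ : Set (PointedCone ℚ (κ → ℚ))) →
        LinearIndepOn ℚ id (bary '' (Φ : Set (PointedCone ℚ (κ → ℚ)))) := by
  classical
  intro Φ
  induction Φ using Finset.strongInduction with
  | H Φ ih =>
    intro hΦ h0 hch
    rcases Φ.eq_empty_or_nonempty with rfl | hne
    · simp
    obtain ⟨μ, hμ⟩ := Finset.exists_maximal hne
    have hμΦ : μ ∈ Φ := hμ.1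
    have hμΔ : μ ∈ Δ.cones := hΦ (Finset.mem_coe.mpr hμΦ)
    set Φ' := Φ.erase μ with hΦ'
    have hΦ'Φ : Φ' ⊂ Φ := Finset.erase_ssubset hμΦ
    have hih : LinearIndepOn ℚ id (bary '' (Φ' : Set (PointedCone ℚ (κ → ℚ)))) :=
      ih Φ' hΦ'Φ (fun φ hφ => hΦ (Finset.mem_coe.mpr (Finset.mem_of_mem_erase (Finset.mem_coe.mp hφ))))
        (fun h => h0 (Finset.mem_of_mem_erase h)) (hch.mono (by rw [Finset.coe_erase]; exact fun x hx => hx.1))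
    -- `bary μ` is outside the span of the other barycentres
    have hout : bary μ ∉ Submodule.span ℚ (bary '' (Φ' : Set (PointedCone ℚ (κ → ℚ)))) := by
      rcases Φ'.eq_empty_or_nonempty with hΦ'e | hne'
      · rw [hΦ'e, Finset.coe_empty, Set.image_empty, Submodule.span_empty, Submodule.mem_bot]
        exact bary_ne_zero (hΔ hμΔ) (Δ.salient hμΔ) fun h => h0 (h ▸ hμΦ)
      · obtain ⟨μ', hμ'⟩ := Finset.exists_maximal hne'
        have hμ'Φ' : μ' ∈ Φ' := hμ'.1
        have hμ'Φ : μ' ∈ Φ := Finset.mem_of_mem_erase hμ'Φ'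
        have hμ'Δ : μ' ∈ Δ.cones := hΦ (Finset.mem_coe.mpr hμ'Φ)
        have hμ'μ : μ' ≤ μ := le_of_maximal_of_isChain hch hμ hμ'Φ
        have hne : μ' ≠ μ := Finset.ne_of_mem_erase hμ'Φ'
        have hface : μ'.IsFaceOf μ := Δ.isFaceOf_of_le hμΔ hμ'Δ hμ'μ
        have hch' : IsChain (· ≤ ·) (Φ' : Set (PointedCone ℚ (κ → ℚ))) :=
          hch.mono (by rw [hΦ', Finset.coe_erase]; exact fun x hx => hx.1)
        have hspan : Submodule.span ℚ (bary '' (Φ' : Set (PointedCone ℚ (κ → ℚ)))) ≤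
            Submodule.span ℚ (μ' : Set (κ → ℚ)) := by
          refine Submodule.span_mono ?_
          rintro _ ⟨φ, hφ, rfl⟩
          have hφΦ' : φ ∈ Φ' := Finset.mem_coe.mp hφ
          exact le_of_maximal_of_isChain hch' hμ' hφΦ'
            (bary_mem (Δ.fg (hΦ (Finset.mem_coe.mpr (Finset.mem_of_mem_erase hφΦ')))))
        exact fun h => bary_not_mem_span_of_isFaceOf_ne (hΔ hμΔ) (Δ.salient hμΔ) hface hne (hspan h)
    have hins : bary '' (Φ : Set (PointedCone ℚ (κ → ℚ))) =
        insert (bary μ) (bary '' (Φ' : Set (PointedCone ℚ (κ → ℚ)))) := by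
      rw [hΦ', Finset.coe_erase, ← Set.image_insert_eq, Set.insert_sdiff_singleton,
        Set.insert_eq_of_mem (Finset.mem_coe.mpr hμΦ)]
    rw [hins]
    exact hih.id_insert hout

/-- The barycentre map is injective on a finite set of cones of a rational fan: the image has the
same cardinality. [cite: KempfEtAl1973, II §2] -/
theorem card_image_bary [DecidableEq (κ → ℚ)] (hΔ : Δ.IsRational)
    {Φ : Finset (PointedCone ℚ (κ → ℚ))} (hΦ : ↑Φ ⊆ Δ.cones) : (Φ.image bary).card = Φ.card :=
  Finset.card_image_of_injOn fun _ hφ _ hψ h => bary_injOn hΔ (hΦ hφ) (hΦ hψ) h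

/-- **Flag cones of chains are simplicial.** [cite: KempfEtAl1973, II §2] -/
theorem isSimplicial_flagCone (hΔ : Δ.IsRational) {Φ : Finset (PointedCone ℚ (κ → ℚ))}
    (hΦ : ↑Φ ⊆ Δ.cones) (h0 : ⊥ ∉ Φ) (hch : IsChain (· ≤ ·) (Φ : Set (PointedCone ℚ (κ → ℚ)))) :
    (flagCone (Φ : Set (PointedCone ℚ (κ → ℚ)))).IsSimplicial :=
  ⟨bary '' (Φ : Set _), (Φ.finite_toSet.image _), linearIndepOn_bary_of_isChain hΔ Φ hΦ h0 hch, rfl⟩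

/-- The flag cone of a chain of cones of a fan lies in the maximal cone of the chain, hence in the
support. [cite: KempfEtAl1973, II §2] -/
theorem flagCone_le_of_maximal {Φ : Finset (PointedCone ℚ (κ → ℚ))} (hΦ : ↑Φ ⊆ Δ.cones)
    (hch : IsChain (· ≤ ·) (Φ : Set (PointedCone ℚ (κ → ℚ)))) {μ : PointedCone ℚ (κ → ℚ)}
    (hμ : Maximal (· ∈ Φ) μ) : flagCone (Φ : Set (PointedCone ℚ (κ → ℚ))) ≤ μ :=
  flagCone_le (fun _ hφ => Δ.fg (hΦ hφ)) fun _ hφ => le_of_maximal_of_isChain hch hμ (Finset.mem_coe.mp hφ)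

/-- **Dimension of a flag cone** = length of the chain: the span of `flagCone Φ` has dimension
`Φ.card`. [cite: KempfEtAl1973, II §2] -/
theorem finrank_span_flagCone [DecidableEq (κ → ℚ)] (hΔ : Δ.IsRational)
    {Φ : Finset (PointedCone ℚ (κ → ℚ))} (hΦ : ↑Φ ⊆ Δ.cones) (h0 : ⊥ ∉ Φ)
    (hch : IsChain (· ≤ ·) (Φ : Set (PointedCone ℚ (κ → ℚ)))) :
    Module.finrank ℚ (Submodule.span ℚ (flagCone (Φ : Set (PointedCone ℚ (κ → ℚ))) : Set (κ → ℚ))) =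
      Φ.card := by
  rw [flagCone, span_coe_hull, ← Finset.coe_image, finrank_span_finset_eq_card, card_image_bary hΔ hΦ]
  rw [Finset.coe_image]
  exact (linearIndepOn_bary_of_isChain hΔ Φ hΦ h0 hch).linearIndependent

end Fan

end Flag

end Literature.Geometry.PolyhedralFans

end
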